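import Summits.ValiantsHypothesis.ValiantsHypothesis.Theses.BorderApolarity
import Summits.ValiantsHypothesis.ValiantsHypothesis.Theorems.BorderApolarityFixedWitnessObstructionQPIffGctThesis
import Summits.ValiantsHypothesis.ValiantsHypothesis.Theorems.ToricFixedPoints.Negative.WithoutUpperLimitFalse
import Literature.Computability.AlgebraicComplexity.Apolarity
import Literature.Computability.AlgebraicComplexity.ApolarityAction
import Literature.Computability.AlgebraicComplexity.BorderApolarityMembership
import Literature.Computability.AlgebraicComplexity.BorderDcQuadraticBoundProofs
import Literature.Computability.AlgebraicComplexity.DeterminantalComplexityProofs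
import Literature.Computability.AlgebraicComplexity.PermanentVsDeterminantProofs
import Literature.Computability.AlgebraicComplexity.StandardFamiliesProofs
import Literature.Computability.AlgebraicComplexity.DeterminantalConormalBoundKernelAlgebra
import Literature.Computability.AlgebraicComplexity.AlperBogartVelascoProofs

/-!
# Disproof work file — crux `ToricWitnessObstructionQP` (stmt-ValiantsHypothesis-14753) — findings

Standing adversary (cdisprove, cycle 1, refuter-cdisprove-stmt-ValiantsHypothesis-14753-0, 2026-08-16).
Route `BorderApolarity`, decl
`Summit.ValiantsHypothesis.ValiantsHypothesis.Theses.BorderApolarity.ToricWitnessObstructionQP` (=: T).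
Parent crux X = `FixedWitnessObstructionQP` (stmt-5778) has its own disproof file
`Cruxes/FixedWitnessObstructionQP/Disproof.lean` (read it first: §1 sandwich, §3/§10/§11 load-bearing
table, §4 thresholds, §9 apolarity API); everything there about the WITNESS NOTION transfers to T,
whose witnesses are the special witnesses `P_t = Q_t := u·diag((t+2)^w)·g·det_m` (toric curves).

## Findings (index)

* §0 `ToricWitnessExists`, `crux_iff` (`Iff.rfl`): T ↔ ∀ c ∃ n₀ ∀ n ≥ n₀ ∀ m in the window,
  ¬ ToricWitnessExists n m.
* §1 THE SANDWICH (all landed, nothing conditional):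
  `GctThesis → X → T` (`toricWitnessObstructionQP_of_gctThesis`,
  `toricWitnessObstructionQP_of_fixedWitnessObstructionQP`, Theorems/…IffGctThesis.lean), `X ↔ GctThesis`
  (`fixedWitnessObstructionQP_iff_gctThesis`, Borel support item PROVED), and `T ↔ GctThesis` GIVEN
  crux 3 `ToricFixedPoints` (`toricWitnessObstructionQP_iff_gctThesis`).  CONSEQUENCE FOR DISPROOF
  (`not_gctThesis_of_not_crux`): ¬T ⟹ ¬GctThesis, i.e. a refutation of T is a quasi-polynomial upper
  bound on the BORDER determinantal complexity of infinitely many padded permanents, by EXPLICIT toric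
  degenerations with H₀-stable limit ideals.  Out of reach: T resists every cheap attack for the same
  reason the Mulmuley–Sohoni conjecture does.  (T is formally WEAKER than X by exactly crux 3.)
* §1b POINTWISE: `mem_of_toricWitnessExists` (toric witness ⟹ `pp ∈ Δ(det_m)`, from the landed
  `mem_orbitClosure_of_witness`; uses only W3@m, W5@m), `not_toricWitnessExists_of_lt` (LMR13 `n² ≤ 2m`,
  proved in tree: NO toric witness when `2m < n²`, e.g. `(3,4)`, `(4,7)`, `(5,12)`), and the slices
  `crux_slice_zero` (c = 0: empty window) and `crux_slice_one` (c = 1: `m ≤ 2n`, killed by LMR,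
  threshold 5) — THE CONTENT OF T STARTS AT c = 2, like X.
* §2 THRESHOLD IS LOAD-BEARING: `toricWitness_one` — at `(n, m) = (n, 1)` the toric curve with
  `u = g = 1, w = 0` is `X₀₀`, `Ann_{≤1}(X₀₀) = 0`, so `J = {0}` is an honest toric witness; hence
  `threshold_ge_two : every valid n₀(c) ≥ 2` (LANDED: Negative/ThresholdGeTwo.lean, p99297).  Upper
  thresholds (`n₀(2) ≥ 65` etc., parent §4) need an H₀-STABLE toric witness at `m = 2ⁿ − 1` (Grenet's
  point of `End·det_m` is a 0/1-weight toric limit, parent's `exists_extremal_zeroOne_of_mem_endOrbit`,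
  but the H₀-stability of ITS limit ideal is exactly crux-3 territory) — not constructed; see §5(b).
* §3 LOAD-BEARING CLAUSES of the toric witness (inherits parent §3/§10/§11 verbatim, the junk
  witnesses there being toric with `w = 0`): W3 (limsup) load-bearing (`J ≡ {0}` junk otherwise), W5
  (apolarity) load-bearing (`(det_n, Ann det_n)` at `(n,n)` is an H₀(n,n)-stable toric junk witness —
  `toricCrux_false_without_apolar`, transfer of parent `false_without_apolar`; PROVED in full in
  Negative/WithoutApolarFalse.lean (proposal p101560, torus + closedness lemmas re-typed) and kept with
  `sorry` in this work file only to avoid a 200-line duplicate), W2 and W4 logically FREE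
  (`GctThesis ⟹ T` never uses them).  New for T: the toric SHAPE of
  `Q_t` is what makes T weaker than X; dropping it gives X back.
* §4 LINE `Sketch` (PICKED; skeleton `Lines/Sketch.lean`, stubs S1–S6):
  - S1 (Lie/Euler identity through `u`), S2 (Lie stabiliser of `per_n`, `n ≥ 3`, = torus), S3 (padded,
    from S2 by ℓ-degree separation), S4 (eigen-completion; holds for all `s` incl. `s = 0` by polynomial
    functional calculus), S5 (specialise ℓ = 1, z = 0) were AUDITED ON PAPER: correct as typed (index
    conventions `linSubst A : X_i ↦ Σ_j A_ji X_j`, `N = u diag(w) u⁻¹` check out; the two `sorry`s inside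
    `stub_normalForm` — extremality and the representation for `(p⁻¹u)·g, w'` — follow from S4's
    conjugation identity by comparing `s`-coefficients, using the file's own
    `isWeightedHomogeneous_of_linSubst_diagonal_two`).  `3 ≤ n` is load-bearing in S2 (at `n = 2`,
    `X₀₀∂₁₀ − X₀₁∂₁₁` kills `per_2`: LANDED Negative/StubLieStabilizerPerFalseAtTwo.lean, p100183) and in
    S6 (`TLF(2,2)` by `per_2 = det`, proposal p101619 Negative/StubToricBorderLowerFalseWithoutThree.lean).
  - S6 `stub_toricBorderLower` (the only open stub) is NOT a small residue: `tlf_of_hasDetRepr` (affine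
    determinantal expressions are torus leading forms with all weights 0) gives
    **S6 ⟹ `dc(per_n) = 2ⁿ − 1` for every `n ≥ 3`** (`determinantalComplexity_perPoly_eq_of_S6`, with
    Grenet's bound proved in tree): exact optimality of Grenet for all `n`, deciding e.g. the open
    `dc(per_4) = 15`, an EXPONENTIAL affine lower bound — Valiant's-hypothesis strength on its own.
    (LANDED: Negative/StubToricBorderLowerStrength.lean, p99141; stub note `stub_toricBorderLower.md` on
    the item with the NoTLFQP signature.)  The crux only needs the eventual quasi-polynomial form NoTLFQP;
    recommend the lead reshape S6 to it NOW rather than after a kill.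
  - S6 AT n = 3 (the falsifiable bet `toric-bdc(per_3) = 7`): (i) its affine part is ABV's theorem
    `dc(per_3) = 7` (in tree, `S6_consistent_three`); (ii) `TLF(3, m)` for `m ≤ 4` is false by LMR
    (a TLF gives border membership — informal, §5(c)); (iii) NEW OBSERVATION: for the DEGREE-FILTRATION
    weights (`a₀ > 0`, `γ = 0`: "per_3 is the lowest-order part of det(Λ + L(Y))") ABV's proof applies
    VERBATIM to the relaxed problem — corank Λ ≥ 2 forces `per_3 ∈ (a, b)` or `per_3 = det₃(linear)`,
    excluded by vzG's `codim Sing ≥ 5` (in tree); corank 1 gives `Z₁₁ = 0`, isotropy `Σ Z₁ⱼZⱼ₁ = 0` from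
    the vanishing quadratic part, `per_3 ∈ I²` for the row/column ideal `I` of `≤ m − 1` linear forms,
    hence a linear space of dim `≥ 9 − (m−1)` inside `Sing(per_3)`, so `m − 1 ≥ 6`: NO degree-filtration
    TLF of `per_3` below size 7.  So a counterexample to S6 at `n = 3` needs weights with LOW-ORDER garbage
    (constant/linear/quadratic terms allowed below `per_3` in the `φ`-order, `φ(d) = a₀(m−|d|) + Σαᵢrᵢ +
    Σβⱼcⱼ`), where the origin is no longer a triple point and ABV's isotropy step has no anchor.
    (iv) NUMERICAL SEARCH (script `compute/tlf/tlfsearch.py` in the refuter folder, bundled with every job;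
    evidence `compute-<id>.json` on the item).  Formulation: `TLF(n,m)` with weight `φ(d) = a₀(m−|d|) + Σαᵢrᵢ(d)
    + Σβⱼcⱼ(d)` ⟺ the coefficients of `F = det(Λ + Σ Y_ij G_ij)` are `1` on permutation patterns, `0` on
    `{d : φ(d) ≥ φ(per), d ∉ Perm}`, free elsewhere; coefficients extracted by least squares from values at
    `1.5×#monomials` random torus points (extraction error 1e-15), L-BFGS from random (half corank-forced)
    starts + Levenberg–Marquardt polish with analytic Jacobians; an EXACT solution polishes to rel ≈ 1e-28.
    CALIBRATION: Grenet's 7×7 evaluates to rel 1e-31; perturbed Grenet polishes back to 1e-31 (bilinear form)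
    / 1e-18 (general); the bilinear width-6 problem `per_3 = uᵀNv, u·v = 0` (Grenet's shape) is solved
    EXACTLY from random starts in 6/24 runs (j017202); the exact affine `m = 7` problem reaches 1e-10 in
    the best of 12 runs with a 15-step polish (j017204); exact `m = 5, 6` controls floor at rel 0.225 / 0.236
    (dc(per_3) = 7).  RESULTS: `m = 5`, all 15 weight classes with ≤ 450 constraints + lower-degree class
    (j017205, 12 restarts each): best rel 2.5e-8 … 5e-7, NONE exact; `m = 6`, classes with ≤ 650
    constraints (j017204): best rel 1.3e-8 … 5e-7, NONE exact; bilinear width 5 (= degree-filtration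
    `TLF(3,6)`, provably infeasible by (iii)): 346 runs, best 5.8e-9 with parameter norm 1300, none exact —
    i.e. the 1e-8-level near-solutions are VALLEYS (j017339: loss 4e-8 → 1.4e-10 while the norm doubles),
    the signature of an unattained infimum of the PROJECTED problem, not of a border expression: pushing
    valley points along their torus (`s = 3 … 1000`) and measuring the scale-free distance of
    `det(s^{a₀}ℓΛ + Σ s^γ Y G)` to `ℓ²per_3` gives r₀ ≈ 0.74–1.0 (j017607), and the direct membership probe
    from there falls to the same floor r ≈ 0.2245 as 40 random starts (m = 5; m = 6: 0.233) — BUT that probe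
    is WEAK (its calibration `ℓ⁴per_3 ∈ End·det_7` reached only r = 0.064 in the best of 5 runs), so the
    floors say nothing about `bdc(per_3)`.  NET: no torus leading form of `per_3` of size 5 or 6 was found
    in any small weight class by a method that does find them where they exist; S6 at `n = 3` survives
    the cheap attack; `bdc(per_3) ∈ {5, 6, 7}` stays open.  A long-shot affine search for `dc(per_4) ≤ 14`
    (j017307) did not converge (rel ≈ 0.44 on sample points, worse on fresh points) and was stopped.
* §5 WHY T RESISTS / WHAT WOULD KILL IT: (a) ¬T needs `bdc(per_n) ≤ 2^{polylog}` i.o. (§1);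
  (b) even the WINDOW-FREE variant "no H₀-stable toric witness at any `m ≥ n`" is not refuted here: at
  `m = 2ⁿ − 1` Grenet gives `pp ∈ End·det_m` as a 0/1-toric limit `u·lim diag((t+2)^{-e_S})·g·det_m`, but
  whether the Kuratowski limit of `Ann(Q_t)` along THAT curve is H₀(n,m)-stable is open (Borel only
  gives SOME fixed point of the closed H₀-stable set of limits ⊆ pp^⊥, and its toric shape is crux 3);
  (c) informal: `TLF(n,m) ⟹ X₀₀^{m−n}per_n ∈ Δ(det_m)` (homogenise `det(s^{a₀}ℓG₀ + Σ s^γ Y G)`, divide by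
  `s^{e'}`, let `s → ∞`), so S6 is TRUE wherever `2m < n²`.

Nothing in this file refutes T.  VERDICT (cycle 1): T resists because `GctThesis ⟹ T` is a theorem;
the line's open stub S6 is VH-hard in general and, at `n = 3`, open exactly on the non-degree weight
classes (numerics pending).
-/

namespace Summit.ValiantsHypothesis.ValiantsHypothesis.Cruxes.ToricWitnessObstructionQP.Disproof

open Literature.Computability.AlgebraicComplexity
open Summit.ValiantsHypothesis.ValiantsHypothesis.Theses
open Summit.ValiantsHypothesis.ValiantsHypothesis.Theses.BorderApolarity
open Summit.ValiantsHypothesis.ValiantsHypothesis.Theorems.BorderApolarityFixedWitnessObstructionQP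
open Filter MvPolynomial
open scoped Matrix BigOperators

set_option linter.dupNamespace false

noncomputable section

/-! ## §0 Vocabulary -/

/-- `rk` weight used by the crux to order the variables (ℓ = (0,0) and the Y-block first). -/
def rk (n m : ℕ) [NeZero m] (p : Fin m × Fin m) : ℕ :=
  (if (m - n ≤ (p.1 : ℕ) ∧ m - n ≤ (p.2 : ℕ)) ∨ p = (0, 0) then 0 else m * m) + ((p.1 : ℕ) * m + (p.2 : ℕ))

/-- W4 of the crux: stability of `J` under `D ↦ linSubst Mᵀ D` for every `M ∈ H₀(n,m)`, verbatim. -/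
def IsH0Stable (n m : ℕ) [NeZero m] (J : ℕ → Set (MvPolynomial (Fin m × Fin m) ℂ)) : Prop :=
  ∀ A : Matrix.GeneralLinearGroup (Fin m × Fin m) ℂ,
    let M : Matrix (Fin m × Fin m) (Fin m × Fin m) ℂ := A
    (∀ i j : Fin m × Fin m, M j i ≠ 0 → rk n m j ≤ rk n m i) →
    (∀ i j : Fin m × Fin m, ((m - n ≤ (i.1 : ℕ) ∧ m - n ≤ (i.2 : ℕ)) ∨ i = (0, 0)) → j ≠ i → M j i = 0) →
    (∀ i k j l : Fin m, m - n ≤ (i : ℕ) → m - n ≤ (k : ℕ) → m - n ≤ (j : ℕ) → m - n ≤ (l : ℕ) →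
      M (i, j) (i, j) * M (k, l) (k, l) = M (i, l) (i, l) * M (k, j) (k, j)) →
    M (0, 0) (0, 0) ^ (m - n) * ∏ i ∈ Finset.univ.filter (fun i : Fin m => m - n ≤ (i : ℕ)), M (i, i) (i, i) = 1 →
    ∀ k ≤ m, ∀ D ∈ J k, linSubst (Fin m × Fin m) ℂ Mᵀ D ∈ J k

/-- W5: apolarity to the padded permanent in degrees `≤ m`. -/
def IsApolarPP (n m : ℕ) [NeZero m] (J : ℕ → Set (MvPolynomial (Fin m × Fin m) ℂ)) : Prop :=
  ∀ k ≤ m, ∀ D ∈ J k, apolarAction D (paddedPerPoly ℂ n m) = 0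

/-- The toric curve `Q_t = u · diag((t+2)^w) · g · det_m` of the crux. -/
def toricCurve (m : ℕ) (u g : Matrix.GeneralLinearGroup (Fin m × Fin m) ℂ) (w : Fin m × Fin m → ℤ)
    (t : ℕ) : MvPolynomial (Fin m × Fin m) ℂ :=
  linSubst (Fin m × Fin m) ℂ (u : Matrix (Fin m × Fin m) (Fin m × Fin m) ℂ)
    (linSubst (Fin m × Fin m) ℂ (Matrix.diagonal fun i : Fin m × Fin m => ((t : ℂ) + 2) ^ (w i))
      (linSubst (Fin m × Fin m) ℂ (g : Matrix (Fin m × Fin m) (Fin m × Fin m) ℂ) (detPoly (Fin m) ℂ)))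

/-- A TORIC Borel-fixed border-apolar witness exists at `(n, m)`: the `∃`-body of the crux, with
W2 ∧ W3 = `IsBorderApolarLimit m Q J` of `Literature/…/Apolarity.lean`. -/
def ToricWitnessExists (n m : ℕ) [NeZero m] : Prop :=
  ∃ (u g : Matrix.GeneralLinearGroup (Fin m × Fin m) ℂ) (w : Fin m × Fin m → ℤ)
    (J : ℕ → Set (MvPolynomial (Fin m × Fin m) ℂ)),
    IsBorderApolarLimit m (toricCurve m u g w) J ∧ IsH0Stable n m J ∧ IsApolarPP n m J

/-- **T unfolded** (by `Iff.rfl`). [folklore] -/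
theorem crux_iff :
    ToricWitnessObstructionQP ↔
      ∀ c : ℕ, ∃ n₀ : ℕ, ∀ n ≥ n₀, ∀ (m : ℕ) [NeZero m], n ≤ m → m ≤ 2 ^ ((Nat.log 2 n + c) ^ c) →
        ¬ ToricWitnessExists n m := by
  unfold ToricWitnessObstructionQP ToricWitnessExists IsBorderApolarLimit toricCurve IsH0Stable IsApolarPP
  simp only [and_assoc]
  rfl

/-! ## §1 The sandwich (all landed) -/

/-- `GctThesis ⟹ T` (landed). [folklore] -/
theorem crux_of_gctThesis (hG : GCTMult.GctThesis) : ToricWitnessObstructionQP :=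
  toricWitnessObstructionQP_of_gctThesis hG

/-- `X ⟹ T` (landed): toric witnesses are witnesses. [folklore] -/
theorem crux_of_parent (hX : FixedWitnessObstructionQP) : ToricWitnessObstructionQP :=
  toricWitnessObstructionQP_of_fixedWitnessObstructionQP hX

/-- **CONSEQUENCE FOR DISPROOF**: a refutation of T refutes the quasi-polynomial Mulmuley–Sohoni
thesis `GCTMult.GctThesis` (and the parent crux X). [folklore] -/
theorem not_gctThesis_of_not_crux (h : ¬ ToricWitnessObstructionQP) :
    ¬ GCTMult.GctThesis ∧ ¬ FixedWitnessObstructionQP :=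
  ⟨fun hG => h (crux_of_gctThesis hG), fun hX => h (crux_of_parent hX)⟩

/-- Given crux 3, T is EQUIVALENT to the thesis (landed). [folklore] -/
theorem crux_iff_gctThesis (hT : ToricFixedPoints) : ToricWitnessObstructionQP ↔ GCTMult.GctThesis :=
  toricWitnessObstructionQP_iff_gctThesis hT

/-! ## §1b Pointwise: a toric witness forces membership; LMR kills small `m`; slices c ≤ 1 -/

/-- A toric witness at `(n, m)` forces `X₀₀^{m−n} per_n ∈ Δ(det_m)` (only W3@m and W5@m are used).
[folklore] -/
theorem mem_of_toricWitnessExists {n m : ℕ} [NeZero m] (hnm : n ≤ m) (h : ToricWitnessExists n m) :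
    paddedPerPoly ℂ n m ∈ orbitClosure (detPoly (Fin m) ℂ) := by
  obtain ⟨u, g, w, J, hlim, -, h5⟩ := h
  exact Literature.Computability.AlgebraicComplexity.BorderApolarity.mem_orbitClosure_of_witness hnm
    (toricCurve m u g w) J
    (fun t => Summit.ValiantsHypothesis.Cruxes.ToricFixedPoints.Negative.toricCurve_mem_glOrbit u g w t)
    hlim.2 h5

/-- **No toric witness when `2m < n²`** (LMR13, proved in tree), e.g. none at `(3,4)`, `(4,7)`,
`(5,12)`. [cite: LandsbergManivelRessayre2013, Theorem 1.1.1] -/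
theorem not_toricWitnessExists_of_lt {n m : ℕ} [NeZero m] (hnm : n ≤ m) (hlt : 2 * m < n ^ 2) :
    ¬ ToricWitnessExists n m := fun h =>
  absurd (LMR2013_thm_1_1_1_holds n m hnm (mem_of_toricWitnessExists hnm h)) (by omega)

theorem not_toricWitnessExists_three_four : ¬ ToricWitnessExists 3 4 :=
  not_toricWitnessExists_of_lt (by norm_num) (by norm_num)

/-- The `c = 0` slice of T holds vacuously (empty window for `n ≥ 3`). [folklore] -/
theorem crux_slice_zero :
    ∃ n₀ : ℕ, ∀ n ≥ n₀, ∀ (m : ℕ) [NeZero m], n ≤ m → m ≤ 2 ^ ((Nat.log 2 n + 0) ^ 0) →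
      ¬ ToricWitnessExists n m := by
  refine ⟨3, fun n hn m _ hnm hm _ => ?_⟩
  simp only [pow_zero, pow_one] at hm
  omega

/-- The `c = 1` slice of T is a THEOREM (threshold 5): `m ≤ 2^(log₂ n + 1) ≤ 2n < n²/2`.
[cite: LandsbergManivelRessayre2013, Theorem 1.1.1] -/
theorem crux_slice_one :
    ∃ n₀ : ℕ, ∀ n ≥ n₀, ∀ (m : ℕ) [NeZero m], n ≤ m → m ≤ 2 ^ ((Nat.log 2 n + 1) ^ 1) →
      ¬ ToricWitnessExists n m := by
  refine ⟨5, fun n hn m _ hnm hm hw => ?_⟩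
  have hlmr : n ^ 2 ≤ 2 * m := LMR2013_thm_1_1_1_holds n m hnm (mem_of_toricWitnessExists hnm hw)
  have hlog : 2 ^ Nat.log 2 n ≤ n := Nat.pow_log_le_self 2 (by omega)
  have hpow : 2 ^ ((Nat.log 2 n + 1) ^ 1) = 2 ^ Nat.log 2 n * 2 := by rw [pow_one, pow_succ]
  have hm' : m ≤ 2 * n := by rw [hpow] at hm; omega
  nlinarith

/-! ## §2 The threshold is load-bearing: the honest toric witness at `m = 1` -/

/-- In one variable, a form of degree `k ≤ 1` apolar to the variable is `0`. [folklore] -/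
theorem eq_zero_of_apolar_X {k : ℕ} (hk : k ≤ 1) {D : MvPolynomial (Fin 1 × Fin 1) ℂ}
    (hD : D.IsHomogeneous k) (h : apolarAction D (X ((0 : Fin 1), (0 : Fin 1))) = 0) : D = 0 := by
  classical
  set v : Fin 1 × Fin 1 := ((0 : Fin 1), (0 : Fin 1)) with hv
  have huniq : ∀ p : Fin 1 × Fin 1, p = v := fun p => Subsingleton.elim _ _
  by_contra hne
  interval_cases k
  · have htot : D.totalDegree = 0 := hD.totalDegree hne
    rw [totalDegree_eq_zero_iff_eq_C] at htot
    rw [htot, apolarAction_C, smul_eq_zero] at h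
    rcases h with h0 | hX
    · exact hne (by rw [htot, h0, C_0])
    · exact X_ne_zero _ hX
  · have hXv : (X v : MvPolynomial (Fin 1 × Fin 1) ℂ) = monomial (Finsupp.single v 1) 1 := rfl
    have hDeq : D = coeff (Finsupp.single v 1) D • X v := by
      ext d
      rw [coeff_smul, hXv, coeff_monomial, smul_eq_mul]
      by_cases hd : Finsupp.single v 1 = d
      · rw [if_pos hd, mul_one, hd]
      · rw [if_neg hd, mul_zero]
        by_contra hcd
        have hdeg := hD hcd
        apply hd
        have hdv : d = Finsupp.single v (d v) := by
          ext p; rw [huniq p, Finsupp.single_eq_same]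
        have hdv1 : d v = 1 := by
          have hw : Finsupp.weight (1 : Fin 1 × Fin 1 → ℕ) (Finsupp.single v (d v)) = 1 := by
            rw [← hdv]; exact hdeg
          simpa [Finsupp.weight_apply, Finsupp.sum_single_index] using hw
        rw [hdv, hdv1]
    rw [hDeq, apolarAction_smul_left, apolarAction_X, pderiv_X_self, smul_eq_zero] at h
    rcases h with h0 | h1
    · exact hne (by rw [hDeq, h0, zero_smul])
    · exact one_ne_zero h1

/-- `0 ⌟ f = 0`. [folklore] -/
theorem apolarAction_zero_left {σ : Type*} (f : MvPolynomial σ ℂ) : apolarAction 0 f = 0 := by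
  unfold apolarAction
  simp [MvPolynomial.support_zero]

/-- The toric curve with `u = g = 1`, `w = 0` at `m = 1` is the variable `X₀₀`. [folklore] -/
theorem toricCurve_one (t : ℕ) : toricCurve 1 1 1 (fun _ => 0) t = X ((0 : Fin 1), (0 : Fin 1)) := by
  have hdet : detPoly (Fin 1) ℂ = X ((0 : Fin 1), (0 : Fin 1)) := by
    unfold detPoly; rw [Matrix.det_fin_one, Matrix.mvPolynomialX_apply]
  have h1 : (Matrix.diagonal fun i : Fin 1 × Fin 1 => ((t : ℂ) + 2) ^ ((fun _ => (0 : ℤ)) i)) = 1 := by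
    simp only [zpow_zero, Matrix.diagonal_one]
  unfold toricCurve
  rw [h1, Units.val_one, linSubst_one, hdet]
  rfl

/-- **The honest toric witness at `(n, 1)`**: `J = {0}` along the constant toric curve `X₀₀`.
[folklore] -/
theorem toricWitness_one (n : ℕ) : ToricWitnessExists n 1 := by
  classical
  refine ⟨1, 1, fun _ => 0, fun _ => {0}, ⟨?_, ?_⟩, ?_, ?_⟩
  · intro k _ D hD
    have hD0 : D = 0 := hD
    subst hD0
    exact ⟨fun _ => 0, fun t => ⟨isHomogeneous_zero _ _ _, apolarAction_zero_left _⟩,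
      tendsto_const_nhds⟩
  · intro k hk D φ Ds _ hDs hlim
    have hzero : ∀ t, Ds t = 0 := by
      intro t
      have hmem := hDs t
      rw [toricCurve_one] at hmem
      exact eq_zero_of_apolar_X hk hmem.1 hmem.2
    have hlim0 : Tendsto (fun t => coeffVec (Ds t)) atTop
        (nhds (coeffVec (0 : MvPolynomial (Fin 1 × Fin 1) ℂ))) := by
      simp only [hzero]; exact tendsto_const_nhds
    show D = 0
    exact coeffVec_injective (tendsto_nhds_unique hlim hlim0)
  · intro A _M _ _ _ _ k _ D hD
    have hD0 : D = 0 := hD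
    show linSubst (Fin 1 × Fin 1) ℂ (A : Matrix (Fin 1 × Fin 1) (Fin 1 × Fin 1) ℂ)ᵀ D = 0
    rw [hD0, map_zero]
  · intro k _ D hD
    have hD0 : D = 0 := hD
    subst hD0
    exact apolarAction_zero_left _

/-- **Every valid threshold is `≥ 2`, for every `c`**: T with `n₀` deleted is false. [folklore] -/
theorem threshold_ge_two {c n₀ : ℕ}
    (h : ∀ n ≥ n₀, ∀ (m : ℕ) [NeZero m], n ≤ m → m ≤ 2 ^ ((Nat.log 2 n + c) ^ c) →
      ¬ ToricWitnessExists n m) : 2 ≤ n₀ := by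
  by_contra hlt
  exact h 1 (by omega) 1 le_rfl Nat.one_le_two_pow (toricWitness_one 1)

/-! ## §3 Load-bearing clauses (transfer of parent §3/§10/§11) -/

/-- T with the apolarity clause W5 deleted. -/
def CruxWithoutApolar : Prop :=
  ∀ c : ℕ, ∃ n₀ : ℕ, ∀ n ≥ n₀, ∀ (m : ℕ) [NeZero m], n ≤ m → m ≤ 2 ^ ((Nat.log 2 n + c) ^ c) →
    ¬ ∃ (u g : Matrix.GeneralLinearGroup (Fin m × Fin m) ℂ) (w : Fin m × Fin m → ℤ)
        (J : ℕ → Set (MvPolynomial (Fin m × Fin m) ℂ)),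
        IsBorderApolarLimit m (toricCurve m u g w) J ∧ IsH0Stable n m J

/-- NEAR-MISS (true, not re-proved here): W5 is load-bearing for T as for X — at `(n, n)` (inside every
window with `c ≥ 1`) the CONSTANT toric curve `det_n` (`u = g = 1, w = 0`) with `J_k = Ann_k(det_n)` is a
border-apolar limit (closedness of `Ann_k`, parent `mem_annihilatorOfDegree_of_tendsto`) and is
H₀(n,n)-stable (H₀(n,n) is the rank-one torus `diag(aᵢbⱼ)`, `Π aᵢbᵢ = 1`, and `det(aᵢbⱼx_ij) = Πa Πb det`;
parent `isH0Stable_ann_detPoly`, `junkWitness_det`, `false_without_apolar`, Cruxes work file §11).  The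
proof transfers verbatim; it is `sorry`ed here only because that work file cannot be imported and its
~120-line torus computation was not re-typed in cycle 1. [folklore] -/
theorem toricCrux_false_without_apolar : ¬ CruxWithoutApolar := by
  sorry

/-! ## §4 Line `Sketch`: calibration of the open stub S6 (`stub_toricBorderLower`) -/

/-- `TLF n m` — torus leading form of size `m` for `per_n`: the hypothesis of S6, verbatim. -/
def TLF (n m : ℕ) : Prop :=
  ∃ (e' a₀ : ℕ) (γ : Fin n → Fin n → ℕ) (G₀ : Matrix (Fin m) (Fin m) ℂ)
      (G : Fin n → Fin n → Matrix (Fin m) (Fin m) ℂ),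
      (∀ i j k l : Fin n, γ i j + γ k l = γ i l + γ k j) ∧
      (Matrix.of fun a b : Fin m => Polynomial.monomial a₀ (C (G₀ a b)) +
        ∑ i : Fin n, ∑ j : Fin n, Polynomial.monomial (γ i j) (C (G i j a b) * X (i, j)) :
          Matrix (Fin m) (Fin m) (Polynomial (MvPolynomial (Fin n × Fin n) ℂ))).det.natDegree ≤ e' ∧
      (Matrix.of fun a b : Fin m => Polynomial.monomial a₀ (C (G₀ a b)) +
        ∑ i : Fin n, ∑ j : Fin n, Polynomial.monomial (γ i j) (C (G i j a b) * X (i, j)) :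
          Matrix (Fin m) (Fin m) (Polynomial (MvPolynomial (Fin n × Fin n) ℂ))).det.coeff e' =
        perPoly (Fin n) ℂ

/-- Stub S6 of `Lines/Sketch.lean`, verbatim up to unfolding `TLF`. -/
def S6 : Prop := ∀ (n m : ℕ), 3 ≤ n → n ≤ m → TLF n m → 2 ^ n - 1 ≤ m

/-- **Affine determinantal expressions are torus leading forms** (all weights `0`; the `s`-matrix is
`A.map C`, `det = C per_n` of `s`-degree `0`). [folklore] -/
theorem tlf_of_hasDetRepr {n m : ℕ} (h : HasDetRepr (perPoly (Fin n) ℂ) m) : TLF n m := by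
  classical
  obtain ⟨A, hdeg, hdet⟩ := h
  refine ⟨0, 0, fun _ _ => 0, fun a b => coeff 0 (A a b),
    fun i j a b => coeff (Finsupp.single (i, j) 1) (A a b), fun _ _ _ _ => rfl, ?_⟩
  have hB : (Matrix.of fun a b : Fin m => Polynomial.monomial 0 (C (coeff 0 (A a b))) +
      ∑ i : Fin n, ∑ j : Fin n, Polynomial.monomial ((fun _ _ => 0 : Fin n → Fin n → ℕ) i j)
        (C (coeff (Finsupp.single (i, j) 1) (A a b)) * X (i, j)) :
          Matrix (Fin m) (Fin m) (Polynomial (MvPolynomial (Fin n × Fin n) ℂ))) =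
      (Polynomial.C : MvPolynomial (Fin n × Fin n) ℂ →+* _).mapMatrix A := by
    refine Matrix.ext fun a b => ?_
    simp only [Matrix.of_apply, RingHom.mapMatrix_apply, Matrix.map_apply,
      Polynomial.monomial_zero_left]
    conv_rhs => rw [DeterminantalConormal.eq_C_add_sum_of_totalDegree_le_one (hdeg a b)]
    rw [map_add, map_sum, Fintype.sum_prod_type]
  rw [hB, ← RingHom.map_det, hdet]
  exact ⟨(Polynomial.natDegree_C _).le, Polynomial.coeff_C_zero⟩

/-- **S6 ⟹ Grenet is exactly optimal for every `n ≥ 3`**: `dc(per_n) = 2ⁿ − 1`. [folklore] -/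
theorem determinantalComplexity_perPoly_eq_of_S6 (hS6 : S6) {n : ℕ} (hn : 3 ≤ n) :
    determinantalComplexity (perPoly (Fin n) ℂ) = 2 ^ n - 1 := by
  refine le_antisymm (determinantalComplexity_perPoly_le_holds ℂ n (by omega)) ?_
  have h := hasDetRepr_determinantalComplexity_holds (perPoly (Fin n) ℂ)
  have hnm : n ≤ determinantalComplexity (perPoly (Fin n) ℂ) := by
    have h1 := totalDegree_le_of_hasDetRepr_holds h
    rw [totalDegree_perPoly_holds, Fintype.card_fin] at h1
    exact h1
  exact hS6 n _ hn hnm (tlf_of_hasDetRepr h)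

/-- e.g. S6 decides the open value `dc(per_4) = 15` (print: `9 ≤ dc(per_4) ≤ 15`). [folklore] -/
theorem determinantalComplexity_perPoly_four_of_S6 (hS6 : S6) :
    determinantalComplexity (perPoly (Fin 4) ℂ) = 15 :=
  determinantalComplexity_perPoly_eq_of_S6 hS6 (by norm_num)

/-- Consistency: the affine content of S6 at `n = 3`, `dc(per_3) ≥ 7`, is ABV's theorem (in tree).
[folklore] -/
theorem S6_consistent_three {m : ℕ} (h : HasDetRepr (perPoly (Fin 3) ℂ) m) : 2 ^ 3 - 1 ≤ m := by
  have h7 := AlperBogartVelasco.seven_le_determinantalComplexity_perPoly_three ℂ two_ne_zero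
  have hle : determinantalComplexity (perPoly (Fin 3) ℂ) ≤ m := Nat.sInf_le h
  omega

/-- OPEN (the falsifiable content of S6 at `n = 3`; a proof of `TLF 3 6` would REFUTE S6 and show
`bdc(per_3) ≤ 6 < 7 = dc(per_3)`; a disproof would settle nothing about T).  Partial result (informal,
§4(iii) of the docblock): TRUE restricted to the degree-filtration weight classes, by ABV verbatim.
Numerics (§4(iv): kit j017204 / j017202): no exact solution in any class with ≤ 650 constraints nor in the
bilinear width-5 form (346 runs), by a method that recovers the width-6 Grenet form exactly in 6/24 runs;
near-solutions are valleys of the projected problem, not border expressions.  Recorded as the standing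
target; NOT claimed either way. -/
theorem not_tlf_three_six : ¬ TLF 3 6 := by
  sorry

/-- OPEN, same status one size down (`bdc(per_3) ≥ 5` only excludes `m ≤ 4`); numerics (kit j017205): all 15
weight classes with ≤ 450 constraints searched at `m = 5`, best rel 2.5e-8…5e-7, none exact; the valleys'
torus pushes are projectively far from `ℓ²per_3` (r₀ ≈ 0.74–1.0, j017607). -/
theorem not_tlf_three_five : ¬ TLF 3 5 := by
  sorry

end

end Summit.ValiantsHypothesis.ValiantsHypothesis.Cruxes.ToricWitnessObstructionQP.Disproof
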